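import Mathlib.Data.Finset.Powerset
import Mathlib.Data.Finset.Card
import Mathlib.Data.Finset.Prod
import Mathlib.Data.Nat.Choose.Basic
import Mathlib.Algebra.BigOperators.Group.Finset.Basic

/-!
# `NoHeavyLowerTail` (crux stmt-CriticalPhenomena-4575), lane prim-ineq-gen-4 (gen 27): block counting of subsets ("peel lemma")

Support file (`--supports stmt-CriticalPhenomena-4575`; memo `run/shared/lean/prim/prim-ineq-gen-4/FINDING-OFFDIAG-UNIVERSAL-g27.md` §7(d)).  No definitions, no `sorry`,
standard axioms.  Infrastructure for TYPE-FREE GRAM IDENTITIES (the Lean route to g26 THEOREM A and to the frame certificates of g22): the number of subsets `w` of a disjoint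
union `A ∪ B` with a prescribed trace on `A` and a prescribed number of elements in `B` factorises (`card_filter_powerset_union`), hence for pairwise disjoint blocks
`P₁, …, P₄` the number of `w ⊆ P₁ ∪ P₂ ∪ P₃ ∪ P₄` with `#(w ∩ Pᵢ) = cᵢ` is `∏ C(#Pᵢ, cᵢ)` (`card_filter_powerset_four_blocks`).  Applied to the blocks
`a ∩ b, a \ b, b \ a, (a ∪ b)ᶜ` this is the count `#{w : #w = j, #(w ∩ a) = α, #(w ∩ b) = β}` entering every Gram identity `∑_w g(#(w∩a)) g'(#(w∩b)) = f(#a, #b, #(a∩b))`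
(tools-g27/gramcert.py, certs/gramcert_k*.json).
-/

namespace Summit.CriticalPhenomena.PercolationContinuityZ3.Theorems.AntiBandBlockCount

open Finset

variable {β : Type*} [DecidableEq β]

/-- **Peel lemma.**  For disjoint finsets `A`, `B`, a decidable property `Φ` of finsets and `c : ℕ`:
`#{w ⊆ A ∪ B : Φ (w ∩ A) ∧ #(w ∩ B) = c} = #{u ⊆ A : Φ u} · C(#B, c)`  (bijection `w ↦ (w ∩ A, w ∩ B)`). [elementary] -/
theorem card_filter_powerset_union (A B : Finset β) (hAB : Disjoint A B) (Φ : Finset β → Prop) [DecidablePred Φ] (c : ℕ) :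
    #((A ∪ B).powerset.filter (fun w => Φ (w ∩ A) ∧ #(w ∩ B) = c))
      = #(A.powerset.filter (fun u => Φ u)) * (#B).choose c := by
  classical
  rw [← Finset.card_powersetCard c B, ← Finset.card_product]
  have hAB' : ∀ x, x ∈ A → x ∉ B := fun x hx hxB => (disjoint_left.mp hAB) hx hxB
  -- the target set is the image of the product under `(u, v) ↦ u ∪ v`
  have himage : (A ∪ B).powerset.filter (fun w => Φ (w ∩ A) ∧ #(w ∩ B) = c)
      = (A.powerset.filter (fun u => Φ u) ×ˢ B.powersetCard c).image (fun uv => uv.1 ∪ uv.2) := by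
    ext w
    rw [mem_filter, mem_powerset, mem_image]
    constructor
    · rintro ⟨hw, hΦ, hc⟩
      refine ⟨(w ∩ A, w ∩ B), ?_, ?_⟩
      · rw [mem_product, mem_filter, mem_powerset, mem_powersetCard]
        exact ⟨⟨inter_subset_right, hΦ⟩, inter_subset_right, hc⟩
      · -- (w ∩ A) ∪ (w ∩ B) = w
        rw [← inter_union_distrib_left]
        exact inter_eq_left.mpr hw
    · rintro ⟨⟨u, v⟩, huv, rfl⟩
      rw [mem_product, mem_filter, mem_powerset, mem_powersetCard] at huv
      obtain ⟨⟨huA, hΦu⟩, hvB, hvc⟩ := huv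
      have huB : u ∩ B = ∅ := by
        rw [← disjoint_iff_inter_eq_empty]
        exact disjoint_left.mpr (fun x hxu hxB => hAB' x (huA hxu) hxB)
      have hvA : v ∩ A = ∅ := by
        rw [← disjoint_iff_inter_eq_empty]
        exact disjoint_left.mpr (fun x hxv hxA => hAB' x hxA (hvB hxv))
      have h1 : (u ∪ v) ∩ A = u := by
        rw [union_inter_distrib_right, hvA, union_empty]; exact inter_eq_left.mpr huA
      have h2 : (u ∪ v) ∩ B = v := by
        rw [union_inter_distrib_right, huB, empty_union]; exact inter_eq_left.mpr hvB
      refine ⟨union_subset_union huA hvB, ?_, ?_⟩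
      · rw [h1]; exact hΦu
      · rw [h2]; exact hvc
  rw [himage]
  apply Finset.card_image_of_injOn
  rintro ⟨u, v⟩ huv ⟨u', v'⟩ huv' heq
  rw [mem_coe, mem_product, mem_filter, mem_powerset, mem_powersetCard] at huv huv'
  simp only at heq
  have hvA : v ∩ A = ∅ := by
    rw [← disjoint_iff_inter_eq_empty]
    exact disjoint_left.mpr (fun x hxv hxA => hAB' x hxA (huv.2.1 hxv))
  have hvA' : v' ∩ A = ∅ := by
    rw [← disjoint_iff_inter_eq_empty]
    exact disjoint_left.mpr (fun x hxv hxA => hAB' x hxA (huv'.2.1 hxv))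
  have huB : u ∩ B = ∅ := by
    rw [← disjoint_iff_inter_eq_empty]
    exact disjoint_left.mpr (fun x hxu hxB => hAB' x (huv.1.1 hxu) hxB)
  have huB' : u' ∩ B = ∅ := by
    rw [← disjoint_iff_inter_eq_empty]
    exact disjoint_left.mpr (fun x hxu hxB => hAB' x (huv'.1.1 hxu) hxB)
  have hu : u = u' := by
    have h1 : (u ∪ v) ∩ A = u := by
      rw [union_inter_distrib_right, hvA, union_empty]; exact inter_eq_left.mpr huv.1.1
    have h2 : (u' ∪ v') ∩ A = u' := by
      rw [union_inter_distrib_right, hvA', union_empty]; exact inter_eq_left.mpr huv'.1.1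
    rw [← h1, ← h2, heq]
  have hv : v = v' := by
    have h1 : (u ∪ v) ∩ B = v := by
      rw [union_inter_distrib_right, huB, empty_union]; exact inter_eq_left.mpr huv.2.1
    have h2 : (u' ∪ v') ∩ B = v' := by
      rw [union_inter_distrib_right, huB', empty_union]; exact inter_eq_left.mpr huv'.2.1
    rw [← h1, ← h2, heq]
  rw [hu, hv]

/-- One block: `#{w ⊆ P : #(w ∩ P) = c} = C(#P, c)`. [elementary] -/
theorem card_filter_powerset_one_block (P : Finset β) (c : ℕ) :
    #(P.powerset.filter (fun w => #(w ∩ P) = c)) = (#P).choose c := by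
  rw [← Finset.card_powersetCard c P, powersetCard_eq_filter]
  congr 1
  apply filter_congr
  intro w hw
  rw [mem_powerset] at hw
  rw [inter_eq_left.mpr hw]

/-- Two blocks: for disjoint `P₁, P₂`, `#{w ⊆ P₁ ∪ P₂ : #(w ∩ P₁) = c₁ ∧ #(w ∩ P₂) = c₂} = C(#P₁,c₁)·C(#P₂,c₂)`. [elementary] -/
theorem card_filter_powerset_two_blocks (P₁ P₂ : Finset β) (h12 : Disjoint P₁ P₂) (c₁ c₂ : ℕ) :
    #((P₁ ∪ P₂).powerset.filter (fun w => #(w ∩ P₁) = c₁ ∧ #(w ∩ P₂) = c₂)) = (#P₁).choose c₁ * (#P₂).choose c₂ := by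
  have h := card_filter_powerset_union P₁ P₂ h12 (fun u => #(u ∩ P₁) = c₁) c₂
  have hcongr : (P₁ ∪ P₂).powerset.filter (fun w => #(w ∩ P₁) = c₁ ∧ #(w ∩ P₂) = c₂)
      = (P₁ ∪ P₂).powerset.filter (fun w => #(w ∩ P₁ ∩ P₁) = c₁ ∧ #(w ∩ P₂) = c₂) := by
    apply filter_congr
    intro w _
    rw [inter_assoc, inter_self]
  rw [hcongr, h, card_filter_powerset_one_block]

/-- Three blocks (pairwise disjoint). [elementary] -/
theorem card_filter_powerset_three_blocks (P₁ P₂ P₃ : Finset β) (h12 : Disjoint P₁ P₂) (h13 : Disjoint P₁ P₃) (h23 : Disjoint P₂ P₃)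
    (c₁ c₂ c₃ : ℕ) :
    #((P₁ ∪ P₂ ∪ P₃).powerset.filter (fun w => #(w ∩ P₁) = c₁ ∧ #(w ∩ P₂) = c₂ ∧ #(w ∩ P₃) = c₃))
      = (#P₁).choose c₁ * (#P₂).choose c₂ * (#P₃).choose c₃ := by
  have hd : Disjoint (P₁ ∪ P₂) P₃ := disjoint_union_left.mpr ⟨h13, h23⟩
  have h := card_filter_powerset_union (P₁ ∪ P₂) P₃ hd (fun u => #(u ∩ P₁) = c₁ ∧ #(u ∩ P₂) = c₂) c₃
  have hcongr : (P₁ ∪ P₂ ∪ P₃).powerset.filter (fun w => #(w ∩ P₁) = c₁ ∧ #(w ∩ P₂) = c₂ ∧ #(w ∩ P₃) = c₃)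
      = (P₁ ∪ P₂ ∪ P₃).powerset.filter (fun w => (#(w ∩ (P₁ ∪ P₂) ∩ P₁) = c₁ ∧ #(w ∩ (P₁ ∪ P₂) ∩ P₂) = c₂) ∧ #(w ∩ P₃) = c₃) := by
    apply filter_congr
    intro w _
    have e1 : w ∩ (P₁ ∪ P₂) ∩ P₁ = w ∩ P₁ := by
      rw [inter_assoc, inter_eq_right.mpr subset_union_left]
    have e2 : w ∩ (P₁ ∪ P₂) ∩ P₂ = w ∩ P₂ := by
      rw [inter_assoc, inter_eq_right.mpr subset_union_right]
    rw [e1, e2, and_assoc]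
  rw [hcongr, h, card_filter_powerset_two_blocks P₁ P₂ h12 c₁ c₂]

/-- **Four blocks.**  For pairwise disjoint `P₁, P₂, P₃, P₄` and `c₁, …, c₄ : ℕ`:
`#{w ⊆ P₁ ∪ P₂ ∪ P₃ ∪ P₄ : #(w ∩ Pᵢ) = cᵢ (i = 1..4)} = ∏ᵢ C(#Pᵢ, cᵢ)`.  (With `P = (a ∩ b, a \\ b, b \\ a, (a ∪ b)ᶜ)` this is the count behind every
type-free Gram identity, memo §7(d).) [elementary] -/
theorem card_filter_powerset_four_blocks (P₁ P₂ P₃ P₄ : Finset β) (h12 : Disjoint P₁ P₂) (h13 : Disjoint P₁ P₃) (h14 : Disjoint P₁ P₄)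
    (h23 : Disjoint P₂ P₃) (h24 : Disjoint P₂ P₄) (h34 : Disjoint P₃ P₄) (c₁ c₂ c₃ c₄ : ℕ) :
    #((P₁ ∪ P₂ ∪ P₃ ∪ P₄).powerset.filter (fun w => #(w ∩ P₁) = c₁ ∧ #(w ∩ P₂) = c₂ ∧ #(w ∩ P₃) = c₃ ∧ #(w ∩ P₄) = c₄))
      = (#P₁).choose c₁ * (#P₂).choose c₂ * (#P₃).choose c₃ * (#P₄).choose c₄ := by
  have hd : Disjoint (P₁ ∪ P₂ ∪ P₃) P₄ := disjoint_union_left.mpr ⟨disjoint_union_left.mpr ⟨h14, h24⟩, h34⟩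
  have h := card_filter_powerset_union (P₁ ∪ P₂ ∪ P₃) P₄ hd (fun u => #(u ∩ P₁) = c₁ ∧ #(u ∩ P₂) = c₂ ∧ #(u ∩ P₃) = c₃) c₄
  have hcongr : (P₁ ∪ P₂ ∪ P₃ ∪ P₄).powerset.filter (fun w => #(w ∩ P₁) = c₁ ∧ #(w ∩ P₂) = c₂ ∧ #(w ∩ P₃) = c₃ ∧ #(w ∩ P₄) = c₄)
      = (P₁ ∪ P₂ ∪ P₃ ∪ P₄).powerset.filter (fun w =>
          (#(w ∩ (P₁ ∪ P₂ ∪ P₃) ∩ P₁) = c₁ ∧ #(w ∩ (P₁ ∪ P₂ ∪ P₃) ∩ P₂) = c₂ ∧ #(w ∩ (P₁ ∪ P₂ ∪ P₃) ∩ P₃) = c₃) ∧ #(w ∩ P₄) = c₄) := by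
    apply filter_congr
    intro w _
    have e1 : w ∩ (P₁ ∪ P₂ ∪ P₃) ∩ P₁ = w ∩ P₁ := by
      rw [inter_assoc, inter_eq_right.mpr (subset_union_left.trans subset_union_left)]
    have e2 : w ∩ (P₁ ∪ P₂ ∪ P₃) ∩ P₂ = w ∩ P₂ := by
      rw [inter_assoc, inter_eq_right.mpr (subset_union_right.trans subset_union_left)]
    have e3 : w ∩ (P₁ ∪ P₂ ∪ P₃) ∩ P₃ = w ∩ P₃ := by
      rw [inter_assoc, inter_eq_right.mpr subset_union_right]
    rw [e1, e2, e3]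
    constructor
    · rintro ⟨a1, a2, a3, a4⟩; exact ⟨⟨a1, a2, a3⟩, a4⟩
    · rintro ⟨⟨a1, a2, a3⟩, a4⟩; exact ⟨a1, a2, a3, a4⟩
  rw [hcongr, h, card_filter_powerset_three_blocks P₁ P₂ P₃ h12 h13 h23 c₁ c₂ c₃]

end Summit.CriticalPhenomena.PercolationContinuityZ3.Theorems.AntiBandBlockCount
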